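import Literature.Topology.FourManifolds.MappingTorus
import Literature.Topology.FourManifolds.MappingTorusSymmProofs
import Literature.Topology.FourManifolds.MappingTorusFibreTwist
import Literature.Topology.FourManifolds.CircleSurgery
import Literature.Topology.FourManifolds.Diffeotopy
import Literature.Topology.FourManifolds.CerfGammaFourProofs
import HarnessLib

/-!
# A smooth mapping torus only remembers the extended conjugacy class of the mapping class of its monodromy

For the relational smooth mapping torus `IsMappingTorusOf IT T φ` (`MappingTorus.lean`: `T` is the
open gluing of the cylinders `M × (0, 1)`, `M × (1/2, 3/2)` along `mappingTorusRel φ`) we prove the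
three classical invariances of the total space (Hatcher, *Algebraic Topology*, Ex. 2.48; Gompf,
*More Cappell–Shaneson spheres are standard*, AGT 10 (2010), §2–§3, where they are used for the
`T³`-bundles of the Cappell–Shaneson construction):

* `IsMappingTorusOf.of_isDiffeotopic` — ISOTOPY: a smooth mapping torus of `φ` is one of every `ψ`
  diffeotopic to `φ` (reglue both cylinders by a fibre diffeotopy: the tree's
  `IsOpenGluingWith.fibreTwist_of_eq`, generic fibre);
* `IsMappingTorusOf.conj` — CONJUGATION: a smooth mapping torus of `φ` is one of
  `g⁻¹ ∘ φ ∘ g = (g.trans φ).trans g.symm` (precompose both gluing embeddings with `g × id`);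
* `IsMappingTorusOf.of_extConj` — together with `IsMappingTorusOf.symm` (`MappingTorusSymmProofs.lean`):
  every `ψ` diffeotopic to a conjugate of `φ` or of `φ⁻¹` has the same smooth mapping tori.

These are the general-fibre forms of `IsSurgeredMappingTorusOf.conj` /
`IsSurgeredMappingTorusOf.trans_of_isDiffeotopicToIdRel` (`SurgeredMappingTorus.lean`, fibre `T³`,
with a section circle) without the circle bookkeeping; they were first written for the line
`monodromy-kernel-engine` of crux `ZeroSurgeryExotic.ZseCruxRasmussen` (0-friends of a fibred knot =
bindings with extended-conjugate capped monodromy). Everything is proved; no named facts.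
-/

noncomputable section

open scoped Manifold ContDiff Topology
open Set Function

namespace Literature.Topology.FourManifolds

variable {E H : Type*} [NormedAddCommGroup E] [NormedSpace ℝ E] [TopologicalSpace H]
  {I : ModelWithCorners ℝ E H}
  {ET HT : Type*} [NormedAddCommGroup ET] [NormedSpace ℝ ET] [TopologicalSpace HT]
  {IT : ModelWithCorners ℝ ET HT}
  {M : Type*} [TopologicalSpace M] [ChartedSpace H M] [IsManifold I ∞ M]
  {T : Type*} [TopologicalSpace T] [ChartedSpace HT T]

/-- **Isotopy invariance of smooth mapping tori.** A smooth mapping torus of `φ` is a smooth mapping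
torus of every `ψ` diffeotopic to `φ` (`Diffeomorph.IsDiffeotopic φ ψ`: `ψ ∘ φ⁻¹` is the time-one
stage of a diffeotopy): reparametrise both cylinders by the inverse fibre diffeotopy
(`IsOpenGluingWith.fibreTwist_of_eq`). The mapping torus only sees the mapping class of the monodromy.
[cite: GompfAGT2010, §2] -/
theorem IsMappingTorusOf.of_isDiffeotopic {φ ψ : M ≃ₘ⟮I, I⟯ M} (h : IsMappingTorusOf IT T φ)
    (hφψ : Diffeomorph.IsDiffeotopic φ ψ) : IsMappingTorusOf IT T ψ := by
  obtain ⟨D, hD⟩ := hφψ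
  obtain ⟨jA, jB, hW⟩ := h
  have hW' : IsOpenGluingWith (I.prod 𝓘(ℝ, ℝ)) (I.prod 𝓘(ℝ, ℝ)) IT (mappingTorusRel ⇑φ) jA jB := hW
  refine ⟨_, _, hW'.fibreTwist_of_eq φ D.inv ψ ?_⟩
  intro x
  rw [Diffeotopy.inv_toFun, ← Diffeotopy.coe_stage_symm, hD]
  rfl

/-- Smooth mapping tori of diffeotopic diffeomorphisms are the same manifolds (iff form).
[cite: GompfAGT2010, §2] -/
theorem isMappingTorusOf_congr_of_isDiffeotopic {φ ψ : M ≃ₘ⟮I, I⟯ M}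
    (hφψ : Diffeomorph.IsDiffeotopic φ ψ) : IsMappingTorusOf IT T φ ↔ IsMappingTorusOf IT T ψ :=
  ⟨fun h ↦ h.of_isDiffeotopic hφψ, fun h ↦ h.of_isDiffeotopic hφψ.symm⟩

omit [IsManifold I ∞ M] in
/-- Conjugating the fibre coordinate by `g` conjugates the mapping-torus relation:
`(g x, s) ∼_φ (g y, t) ↔ (x, s) ∼_{g⁻¹φg} (y, t)`. [folklore] -/
theorem mappingTorusRel_conj_iff (φ g : M ≃ₘ⟮I, I⟯ M) (a : M × ↥mappingTorusPieceOne)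
    (b : M × ↥mappingTorusPieceTwo) :
    mappingTorusRel ⇑φ (g a.1, a.2) (g b.1, b.2) ↔ mappingTorusRel ⇑((g.trans φ).trans g.symm) a b := by
  simp only [mappingTorusRel, Diffeomorph.coe_trans, Function.comp_apply]
  have key₁ : g b.1 = g a.1 ↔ b.1 = a.1 := g.injective.eq_iff
  have key₂ : g b.1 = φ (g a.1) ↔ b.1 = g.symm (φ (g a.1)) := by
    constructor
    · intro h'
      rw [← h', Diffeomorph.symm_apply_apply]
    · intro h'
      rw [h', Diffeomorph.apply_symm_apply]
  rw [key₁, key₂]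

/-- **Conjugation invariance of smooth mapping tori.** A smooth mapping torus of `φ` is a smooth
mapping torus of `g⁻¹ ∘ φ ∘ g = (g.trans φ).trans g.symm` for every diffeomorphism `g` of the fibre:
precompose both gluing embeddings with `g × id`, which conjugates `mappingTorusRel`
(Gompf 2010, §3: the Cappell–Shaneson pair "only depends on the conjugacy class of `A`").
[cite: GompfAGT2010, §3] -/
theorem IsMappingTorusOf.conj {φ : M ≃ₘ⟮I, I⟯ M} (h : IsMappingTorusOf IT T φ) (g : M ≃ₘ⟮I, I⟯ M) :
    IsMappingTorusOf IT T ((g.trans φ).trans g.symm) := by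
  obtain ⟨jA, jB, hA, hAo, hB, hBo, hU, hR⟩ := h
  let α : (M × ↥mappingTorusPieceOne) ≃ₘ⟮I.prod 𝓘(ℝ, ℝ), I.prod 𝓘(ℝ, ℝ)⟯ (M × ↥mappingTorusPieceOne) :=
    g.prodCongr (Diffeomorph.refl 𝓘(ℝ, ℝ) (↥mappingTorusPieceOne) ∞)
  let β : (M × ↥mappingTorusPieceTwo) ≃ₘ⟮I.prod 𝓘(ℝ, ℝ), I.prod 𝓘(ℝ, ℝ)⟯ (M × ↥mappingTorusPieceTwo) :=
    g.prodCongr (Diffeomorph.refl 𝓘(ℝ, ℝ) (↥mappingTorusPieceTwo) ∞)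
  have hsA : Surjective α := EquivLike.surjective α
  have hsB : Surjective β := EquivLike.surjective β
  refine ⟨jA ∘ α, jB ∘ β, hA.comp_diffeomorph α, ?_, hB.comp_diffeomorph β, ?_, ?_, fun a b => ?_⟩
  · rwa [hsA.range_comp]
  · rwa [hsB.range_comp]
  · rwa [hsA.range_comp, hsB.range_comp]
  · rw [Function.comp_apply, Function.comp_apply, hR]
    exact mappingTorusRel_conj_iff φ g a b

/-- Conjugation the other way round: a smooth mapping torus of `φ` is one of `g ∘ φ ∘ g⁻¹`.
[cite: GompfAGT2010, §3] -/
theorem IsMappingTorusOf.conj' {φ : M ≃ₘ⟮I, I⟯ M} (h : IsMappingTorusOf IT T φ) (g : M ≃ₘ⟮I, I⟯ M) :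
    IsMappingTorusOf IT T ((g.symm.trans φ).trans g) := by
  have h' := h.conj g.symm
  have heq : ((g.symm.trans φ).trans g.symm.symm) = ((g.symm.trans φ).trans g) :=
    Diffeomorph.ext fun _ => rfl
  rwa [heq] at h'

/-- The predicates for conjugate monodromies agree. [cite: GompfAGT2010, §3] -/
theorem isMappingTorusOf_conj_iff (φ g : M ≃ₘ⟮I, I⟯ M) :
    IsMappingTorusOf IT T ((g.trans φ).trans g.symm) ↔ IsMappingTorusOf IT T φ := by
  refine ⟨fun h ↦ ?_, fun h ↦ h.conj g⟩
  have h' := h.conj' g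
  have heq : ((g.symm.trans ((g.trans φ).trans g.symm)).trans g) = φ := by
    ext x
    simp
  rwa [heq] at h'

/-- **Extended conjugacy.** If `ψ` is diffeotopic to a conjugate of `φ` or of `φ⁻¹`, every smooth
mapping torus of `φ` is a smooth mapping torus of `ψ` (isotopy + conjugation +
`IsMappingTorusOf.symm`). For closed surface bundles over the circle with `b₁ = 1` this is the complete
list of monodromies with diffeomorphic total space (uniqueness of the fibration), which is not
proved here. [cite: HatcherAT2002, Ex. 2.48] -/
theorem IsMappingTorusOf.of_extConj {φ : M ≃ₘ⟮I, I⟯ M}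
    (h : IsMappingTorusOf IT T φ) (ψ g : M ≃ₘ⟮I, I⟯ M)
    (hrel : Diffeomorph.IsDiffeotopic ((g.trans φ).trans g.symm) ψ ∨
      Diffeomorph.IsDiffeotopic ((g.trans φ.symm).trans g.symm) ψ) :
    IsMappingTorusOf IT T ψ := by
  rcases hrel with hrel | hrel
  · exact (h.conj g).of_isDiffeotopic hrel
  · exact (h.symm.conj g).of_isDiffeotopic hrel

end Literature.Topology.FourManifolds

end
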